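import Summits.QuantumFields.BalabanUV.Beta.EriceRemainderEnclosureHistoryAutonomyComparisonLoadBudgetWindow

/-!
# EriceRemainderEnclosureHistoryAutonomyComparisonAgeCompositionIdentification — (E75a) THE IDENTIFICATION FILE OF ROUTE (N), part 1 (structure, loads,
# budget): along every box solution of an isotone memory with floor dominated by a profile `L ≥ 0`, the first-order per-age read weights
# `E k m i = (L_k h_{m+k}³∕2)·Π_{t=m+1+i}^{m+k} g_t` and persistence defects `θ̂_k(m;l) = 1 − (h_{m+k+l}∕h_{m+k})³·Π_{t=m+k+1}^{m+k+l} g_t` satisfy EVERY structural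
# hypothesis of (E71c) `key_of_harnack_load` (signs, horizon, persistence — an IDENTITY on the support —, defect monotonicity) and two of the three data
# orderings of the window-mass majorant chain of (E72a)∕(E74a): **`x̃_y(m) ≤ x_y(m)`** (damped young load ≤ budget load) and **`Ω_m ≤ Ω^u_m = Σ_{k>y}
# x_k(m)·y∕k`** (old mass inside the young window ≤ undamped window mass); and the loads `x_k(m) = k·L_k·h_{m+k}³∕2` lie in (E65a)'s window budget polytope
# AT EVERY PIN (tail flows).  Part 2 (E75b `…IdentificationEnd`): `θ̂_k(m;y) ≤ θ̄(k∕y)` and KEY at the pin from one window-mass inequality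

Cell `pub-balaban`, β-function sub-cell, BINDER row D4 «RemainderConst leaves for Bałaban's split» (`HOME/BINDER-OWNERS.md`; owner lineage `b2b-balaban-beta-an4`;
this file by co-owner #2 lineage `b2b-balaban-beta-d4-p2`, generation 66), β-FLOW TEAM duty (1), FREEZE (0) honoured (def-free; imports (E65a)
`…ComparisonLoadBudgetWindow`; uses `memFlow_tail` (E48a), `load_budget_window`, `load_le_readWindow` (E65a) BY NAME; nothing restated).  Successor item (1)
of README `HOME/b2b-balaban-beta-d4-p2/g65/e74/README.md` §6 — the identification owed since generation 60 (`g62/e71/README.md`, Successor (2)).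

HONEST FRAMING (page 1, verbatim and binding).  *"Discharging BetaPertH makes Bałaban's UV stability UNCONDITIONAL — a real constructive-QFT result; it is
NOT the continuum limit and NOT the Clay problem."*  THIS FILE DISCHARGES NOTHING OF THE KIND.  Elementary real analysis about ABSTRACT functionals on a box
]0,γ]^ℕ with displayed floors, profiles and signs, and about the FIRST-ORDER renewal objects of route (N) built from them — hypotheses of a census, not
facts; the form, signs, ages and moments of Bałaban's (1.22) limit functional are NOT PRINTED ([I] p. 298; GAPS G-t4-U2-1∕-2) and NOT asserted.  Row D4
class UNCHANGED (critical-path width 0; instance 0∕1; D4 DISCHARGE NO DATE).  HONEST DEPENDENCY: continuum YM on T⁴ ⇐ BetaPertH ∧ nine spine estimates (0/9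
proved); BetaPertH ⇐ (D1) ∧ (D4) ∧ CAP+tail; G-an2-4 gates asym, D1 and NE2/3/4.

THE OBJECTS (README `g62/e71/README.md`; `g60/e70/README.md` §PS).  `B` isotone with floor `b > 0`, dominated by the profile `L ≥ 0` on the ages `k < K`
(`Σ_{k<K} L_k·u_k ≤ B u` on the box); `h` a box solution from the pin `gIR` (`MemFlow B gIR h`); at the pin `m` (every tail `h(m+·)` is a box solution from
`h_m`, `memFlow_tail`) the first-order STEP system of route (N) reads the target depth `m+1+i` of age `k` with the weight `E k m i = c_{m,k}·Π_{t=m+1+i}^{m+k} g_t`,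
`c_{m,k} = L_k h_{m+k}³∕2`, for the lags `i < k`, where `g_t ∈ ]0,1]` is the pin damping (`g_t = 1∕(1+f_t)`, `0 ≤ f_t ≤ F_t := Σ_k L_k h_{t+k}³∕2`; §1–§2 take
ANY `0 < g ≤ 1` and any positive non-increasing `h`); the OLD kernel of the stage «young age `y`» consists of the ages `y < k < K`, the young kernel is
`Ky m l = E y m l` (`l < y`); the persistence defect of age `k` under a pin shift by `l` is `θ̂_k(m;l) = 1 − (h_{m+k+l}∕h_{m+k})³·Π_{t=m+k+1}^{m+k+l} g_t`; the
budget loads at the pin are `x_k(m) = k·c_{m,k}`.  All displayed as hypotheses `hE`, `hKy`, `hθ` on bound variables (0 `def`).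

WHAT IS PROVED ([folklore]; 0 `def`, 0 sorry).  §1 STRUCTURE: `prod_damping_pos`, `prod_damping_le_one`, `weight_nonneg` (`hE0`), `weight_eq_zero_of_horizon`
(`hEN`, `N = K`), `young_weight_nonneg` (`hKy0`), `young_weight_eq_zero` (`hKysupp`), `defect_nonneg` (`hθ0`), `defect_lt_one`, **`persistence_eq`** (`E k (m+l) i
= (1 − θ̂_k(m;l))·E k m (i+l)` for `i + l < k`), **`persistence`** (`hpers`), **`defect_mono`** (`hθmono`).  §2 LOADS: **`window_sum_le`** (`Σ_{i<y} E k m i ≤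
x_k(m)·y∕k`), **`window_mass_le_undamped`** (`Ω_m ≤ Ω^u_m`), **`young_load_le`** (`x̃_y(m) ≤ x_y(m)`).  §3 BUDGET AT EVERY PIN: **`load_budget_window_at_pin`**,
`load_le_cap_at_pin`.  NOT CLAIMED: the static closure (budget form or flow form); MONO; (E58′); anything nonlinear; anything printed.
-/
noncomputable section
open Finset

namespace Summit.QuantumFields.BalabanUV.Beta.EriceRemainderEnclosureHistoryAutonomyComparisonAgeCompositionIdentification

open Literature.MathematicalPhysics.QuantumFieldTheory.Balaban1983to89
open Literature.MathematicalPhysics.QuantumFieldTheory.Balaban1983to89.T4BetaStationary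
open Literature.MathematicalPhysics.QuantumFieldTheory.Balaban1983to89.T4BetaFlowWellPosed
open Summit.QuantumFields.BalabanUV.Beta.EriceRemainderEnclosureHistoryAutonomyOrder (memFlow_tail)
open Summit.QuantumFields.BalabanUV.Beta.EriceRemainderEnclosureHistoryAutonomyComparisonLoadBudgetWindow (load_budget_window load_le_readWindow)

variable {B : (ℕ → ℝ) → ℝ} {γ b gIR : ℝ} {L : ℕ → ℝ} {K y : ℕ} {h g : ℕ → ℝ} {E θ : ℕ → ℕ → ℕ → ℝ} {Ky : ℕ → ℕ → ℝ}

/-! ## §1 Structure: signs, horizon, persistence, defect monotonicity -/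

/-- A product of dampings `g_t ∈ ]0,1]` is positive. [folklore] -/
theorem prod_damping_pos (hg : ∀ t, 0 < g t ∧ g t ≤ 1) (s : Finset ℕ) : 0 < ∏ t ∈ s, g t :=
  prod_pos fun t _ => (hg t).1

/-- A product of dampings `g_t ∈ ]0,1]` is at most `1`. [folklore] -/
theorem prod_damping_le_one (hg : ∀ t, 0 < g t ∧ g t ≤ 1) (s : Finset ℕ) : ∏ t ∈ s, g t ≤ 1 :=
  prod_le_one (fun t _ => (hg t).1.le) fun t _ => (hg t).2

/-- **SIGN.**  The old read weights `E k m i = [y < k < K]·[i < k]·(L_k h_{m+k}³∕2)·Π_{t=m+1+i}^{m+k} g_t` are non-negative ((E71c)'s `hE0`). [folklore] -/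
theorem weight_nonneg (hL : ∀ k, 0 ≤ L k) (hh0 : ∀ n, 0 < h n) (hg : ∀ t, 0 < g t ∧ g t ≤ 1)
    (hE : ∀ k m i, E k m i = if y < k ∧ k < K ∧ i < k then L k * h (m + k) ^ 3 / 2 * ∏ t ∈ Ico (m + 1 + i) (m + k + 1), g t else 0) :
    ∀ k m i, 0 ≤ E k m i := by
  intro k m i
  rw [hE]
  split_ifs
  · exact mul_nonneg (div_nonneg (mul_nonneg (hL k) (pow_nonneg (hh0 _).le 3)) (by norm_num)) (prod_damping_pos hg _).le
  · exact le_rfl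

/-- **HORIZON.**  The old read weights vanish at the lags `i ≥ K` ((E71c)'s `hEN` with `N = K`: every age is `< K`, every read lag is `<` its age). [folklore] -/
theorem weight_eq_zero_of_horizon
    (hE : ∀ k m i, E k m i = if y < k ∧ k < K ∧ i < k then L k * h (m + k) ^ 3 / 2 * ∏ t ∈ Ico (m + 1 + i) (m + k + 1), g t else 0) :
    ∀ k m i, K ≤ i → E k m i = 0 := by
  intro k m i hi
  rw [hE, if_neg]
  omega

/-- The young kernel `Ky m l = [l < y]·(L_y h_{m+y}³∕2)·Π_{t=m+1+l}^{m+y} g_t` is non-negative ((E71c)'s `hKy0`). [folklore] -/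
theorem young_weight_nonneg (hL : ∀ k, 0 ≤ L k) (hh0 : ∀ n, 0 < h n) (hg : ∀ t, 0 < g t ∧ g t ≤ 1)
    (hKy : ∀ m l, Ky m l = if l < y then L y * h (m + y) ^ 3 / 2 * ∏ t ∈ Ico (m + 1 + l) (m + y + 1), g t else 0) :
    ∀ m l, 0 ≤ Ky m l := by
  intro m l
  rw [hKy]
  split_ifs
  · exact mul_nonneg (div_nonneg (mul_nonneg (hL y) (pow_nonneg (hh0 _).le 3)) (by norm_num)) (prod_damping_pos hg _).le
  · exact le_rfl

/-- The young kernel is supported on the young window `l < y` ((E71c)'s `hKysupp`). [folklore] -/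
theorem young_weight_eq_zero
    (hKy : ∀ m l, Ky m l = if l < y then L y * h (m + y) ^ 3 / 2 * ∏ t ∈ Ico (m + 1 + l) (m + y + 1), g t else 0) :
    ∀ m l, y ≤ l → Ky m l = 0 := by
  intro m l hl
  rw [hKy, if_neg (not_lt.mpr hl)]

/-- **SIGN OF THE DEFECT.**  Along a positive non-increasing trajectory with dampings in `]0,1]` the persistence defect
`θ̂_k(m;l) = 1 − (h_{m+k+l}∕h_{m+k})³·Π_{t=m+k+1}^{m+k+l} g_t` is non-negative ((E71c)'s `hθ0`). [folklore] -/
theorem defect_nonneg (hh0 : ∀ n, 0 < h n) (hanti : Antitone h) (hg : ∀ t, 0 < g t ∧ g t ≤ 1)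
    (hθ : ∀ k m l, θ k m l = 1 - (h (m + k + l) / h (m + k)) ^ 3 * ∏ t ∈ Ico (m + k + 1) (m + k + l + 1), g t) :
    ∀ k m l, 0 ≤ θ k m l := by
  intro k m l
  rw [hθ]
  have hr : h (m + k + l) / h (m + k) ≤ 1 := (div_le_one (hh0 _)).mpr (hanti (by omega))
  have hr0 : 0 ≤ h (m + k + l) / h (m + k) := div_nonneg (hh0 _).le (hh0 _).le
  have h3 : (h (m + k + l) / h (m + k)) ^ 3 ≤ 1 := pow_le_one₀ hr0 hr
  have := mul_le_mul h3 (prod_damping_le_one hg (Ico (m + k + 1) (m + k + l + 1))) (prod_damping_pos hg _).le zero_le_one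
  linarith

/-- The persistence factor `1 − θ̂_k(m;l)` is positive, i.e. `θ̂ < 1`. [folklore] -/
theorem defect_lt_one (hh0 : ∀ n, 0 < h n) (hg : ∀ t, 0 < g t ∧ g t ≤ 1)
    (hθ : ∀ k m l, θ k m l = 1 - (h (m + k + l) / h (m + k)) ^ 3 * ∏ t ∈ Ico (m + k + 1) (m + k + l + 1), g t) :
    ∀ k m l, θ k m l < 1 := by
  intro k m l
  rw [hθ]
  have : 0 < (h (m + k + l) / h (m + k)) ^ 3 * ∏ t ∈ Ico (m + k + 1) (m + k + l + 1), g t :=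
    mul_pos (pow_pos (div_pos (hh0 _) (hh0 _)) 3) (prod_damping_pos hg _)
  linarith

/-- **PERSISTENCE IS AN IDENTITY ON THE SUPPORT.**  For `i + l < k` (the shifted read stays inside the age's window) the weight on the COMMON target
`m+1+i+l` seen from the deeper pin `m+l` is EXACTLY the persistence factor times the weight seen from `m`:
`E k (m+l) i = (1 − θ̂_k(m;l))·E k m (i+l)` — coefficient decay `(h_{m+k+l}∕h_{m+k})³` times the extra damping `Π_{t=m+k+1}^{m+k+l} g_t`. [folklore] -/
theorem persistence_eq (hh0 : ∀ n, 0 < h n)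
    (hE : ∀ k m i, E k m i = if y < k ∧ k < K ∧ i < k then L k * h (m + k) ^ 3 / 2 * ∏ t ∈ Ico (m + 1 + i) (m + k + 1), g t else 0)
    (hθ : ∀ k m l, θ k m l = 1 - (h (m + k + l) / h (m + k)) ^ 3 * ∏ t ∈ Ico (m + k + 1) (m + k + l + 1), g t)
    {k m i l : ℕ} (hil : i + l < k) : (1 - θ k m l) * E k m (i + l) = E k (m + l) i := by
  rw [hθ, hE, hE]
  by_cases hk : y < k ∧ k < K
  · rw [if_pos ⟨hk.1, hk.2, hil⟩, if_pos ⟨hk.1, hk.2, by omega⟩]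
    have hsplit : (∏ t ∈ Ico (m + 1 + (i + l)) (m + k + 1), g t) * ∏ t ∈ Ico (m + k + 1) (m + k + l + 1), g t =
        ∏ t ∈ Ico (m + l + 1 + i) (m + l + k + 1), g t := by
      rw [prod_Ico_consecutive _ (by omega) (by omega), show m + 1 + (i + l) = m + l + 1 + i by omega,
        show m + k + l + 1 = m + l + k + 1 by omega]
    have hne : h (m + k) ≠ 0 := (hh0 _).ne'
    rw [← hsplit, show m + l + k = m + k + l by omega]
    field_simp
    ring
  · rw [if_neg (fun h3 => hk ⟨h3.1, h3.2.1⟩), if_neg (fun h3 => hk ⟨h3.1, h3.2.1⟩), mul_zero]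

/-- **PERSISTENCE** ((E71c)'s `hpers`): `(1 − θ̂_k(m;l))·E k m (i+l) ≤ E k (m+l) i` for all `k, i, l` — equality on the support (`persistence_eq`), and
`0 ≤ E k (m+l) i` when `i + l ≥ k` (then `E k m (i+l) = 0`). [folklore] -/
theorem persistence (hL : ∀ k, 0 ≤ L k) (hh0 : ∀ n, 0 < h n) (hg : ∀ t, 0 < g t ∧ g t ≤ 1)
    (hE : ∀ k m i, E k m i = if y < k ∧ k < K ∧ i < k then L k * h (m + k) ^ 3 / 2 * ∏ t ∈ Ico (m + 1 + i) (m + k + 1), g t else 0)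
    (hθ : ∀ k m l, θ k m l = 1 - (h (m + k + l) / h (m + k)) ^ 3 * ∏ t ∈ Ico (m + k + 1) (m + k + l + 1), g t)
    (k m l i : ℕ) : (1 - θ k m l) * E k m (i + l) ≤ E k (m + l) i := by
  by_cases hil : i + l < k
  · exact (persistence_eq hh0 hE hθ hil).le
  · have h0 : E k m (i + l) = 0 := by rw [hE, if_neg]; omega
    rw [h0, mul_zero]
    exact weight_nonneg hL hh0 hg hE k (m + l) i

/-- **DEFECT MONOTONICITY** ((E71c)'s `hθmono`): the defect is non-decreasing in the shift, `θ̂_k(m;l) ≤ θ̂_k(m;l')` for `l ≤ l'` (each further step multiplies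
the persistence factor by `(h_{t+1}∕h_t)³·g_{t+1} ≤ 1`). [folklore] -/
theorem defect_mono (hh0 : ∀ n, 0 < h n) (hanti : Antitone h) (hg : ∀ t, 0 < g t ∧ g t ≤ 1)
    (hθ : ∀ k m l, θ k m l = 1 - (h (m + k + l) / h (m + k)) ^ 3 * ∏ t ∈ Ico (m + k + 1) (m + k + l + 1), g t)
    (k m : ℕ) {l l' : ℕ} (hll' : l ≤ l') : θ k m l ≤ θ k m l' := by
  -- the persistence factor `P l = (h_{m+k+l}/h_{m+k})³ · Π` is non-increasing in `l`
  have hstep : ∀ l, (h (m + k + (l + 1)) / h (m + k)) ^ 3 * ∏ t ∈ Ico (m + k + 1) (m + k + (l + 1) + 1), g t ≤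
      (h (m + k + l) / h (m + k)) ^ 3 * ∏ t ∈ Ico (m + k + 1) (m + k + l + 1), g t := by
    intro l
    rw [show m + k + (l + 1) + 1 = m + k + l + 1 + 1 by omega, prod_Ico_succ_top (by omega)]
    have h1 : h (m + k + (l + 1)) / h (m + k) ≤ h (m + k + l) / h (m + k) :=
      div_le_div_of_nonneg_right (hanti (by omega)) (hh0 _).le
    have h2 : (h (m + k + (l + 1)) / h (m + k)) ^ 3 ≤ (h (m + k + l) / h (m + k)) ^ 3 :=
      pow_le_pow_left₀ (div_nonneg (hh0 _).le (hh0 _).le) h1 3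
    have hP : 0 ≤ ∏ t ∈ Ico (m + k + 1) (m + k + l + 1), g t := (prod_damping_pos hg _).le
    calc (h (m + k + (l + 1)) / h (m + k)) ^ 3 * ((∏ t ∈ Ico (m + k + 1) (m + k + l + 1), g t) * g (m + k + l + 1))
        ≤ (h (m + k + l) / h (m + k)) ^ 3 * ((∏ t ∈ Ico (m + k + 1) (m + k + l + 1), g t) * 1) := by
          apply mul_le_mul h2 (mul_le_mul_of_nonneg_left (hg _).2 hP) (mul_nonneg hP (hg _).1.le)
          exact pow_nonneg (div_nonneg (hh0 _).le (hh0 _).le) 3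
      _ = (h (m + k + l) / h (m + k)) ^ 3 * ∏ t ∈ Ico (m + k + 1) (m + k + l + 1), g t := by rw [mul_one]
  have hmono : Antitone fun l => (h (m + k + l) / h (m + k)) ^ 3 * ∏ t ∈ Ico (m + k + 1) (m + k + l + 1), g t :=
    antitone_nat_of_succ_le hstep
  rw [hθ, hθ]
  linarith [hmono hll']

/-! ## §2 Loads: window sums, the undamped window mass, the young load -/

/-- **THE OLD MASS OF ONE AGE INSIDE THE YOUNG WINDOW.**  `Σ_{i<K, i<y} E k m i ≤ (k·L_k·h_{m+k}³∕2)·(y∕k) = x_k(m)·y∕k` for every age `k ≥ 1`: at most `y`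
lags, each weight at most `c_{m,k}` (dampings `≤ 1`). [folklore] -/
theorem window_sum_le (hL : ∀ k, 0 ≤ L k) (hh0 : ∀ n, 0 < h n) (hg : ∀ t, 0 < g t ∧ g t ≤ 1)
    (hE : ∀ k m i, E k m i = if y < k ∧ k < K ∧ i < k then L k * h (m + k) ^ 3 / 2 * ∏ t ∈ Ico (m + 1 + i) (m + k + 1), g t else 0)
    {k : ℕ} (hk : 1 ≤ k) (m : ℕ) :
    ∑ i ∈ (range K).filter (· < y), E k m i ≤ L k * k * h (m + k) ^ 3 / 2 * ((y : ℝ) / k) := by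
  have hkr : (0 : ℝ) < k := by exact_mod_cast hk
  have hc : 0 ≤ L k * h (m + k) ^ 3 / 2 := div_nonneg (mul_nonneg (hL k) (pow_nonneg (hh0 _).le 3)) (by norm_num)
  have hterm : ∀ i ∈ (range K).filter (· < y), E k m i ≤ L k * h (m + k) ^ 3 / 2 := by
    intro i _
    rw [hE]
    split_ifs
    · exact mul_le_of_le_one_right hc (prod_damping_le_one hg _)
    · exact hc
  have hcard : (((range K).filter (· < y)).card : ℝ) ≤ y := by
    have : (range K).filter (· < y) ⊆ range y := fun i hi => by
      simp only [mem_filter, mem_range] at hi ⊢; exact hi.2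
    exact_mod_cast (card_le_card this).trans (card_range y).le
  calc ∑ i ∈ (range K).filter (· < y), E k m i ≤ ∑ _i ∈ (range K).filter (· < y), L k * h (m + k) ^ 3 / 2 := sum_le_sum hterm
    _ = (((range K).filter (· < y)).card : ℝ) * (L k * h (m + k) ^ 3 / 2) := by rw [sum_const, nsmul_eq_mul]
    _ ≤ (y : ℝ) * (L k * h (m + k) ^ 3 / 2) := mul_le_mul_of_nonneg_right hcard hc
    _ = L k * k * h (m + k) ^ 3 / 2 * ((y : ℝ) / k) := by field_simp

/-- **THE OLD MASS INSIDE THE YOUNG WINDOW IS BELOW THE UNDAMPED WINDOW MASS**: `Ω_m = Σ_{k<K} Σ_{i<K, i<y} E k m i ≤ Ω^u_m := Σ_{y<k<K} x_k(m)·y∕k` — the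
datum of the window-mass chain ((E74a); README g65∕e74 §2: route (N)'s `√2·W` was the further bound `y∕k ≤ √2·S_{k,y}∕k`). [folklore] -/
theorem window_mass_le_undamped (hL : ∀ k, 0 ≤ L k) (hh0 : ∀ n, 0 < h n) (hg : ∀ t, 0 < g t ∧ g t ≤ 1)
    (hE : ∀ k m i, E k m i = if y < k ∧ k < K ∧ i < k then L k * h (m + k) ^ 3 / 2 * ∏ t ∈ Ico (m + 1 + i) (m + k + 1), g t else 0)
    (m : ℕ) :
    ∑ k ∈ range K, ∑ i ∈ (range K).filter (· < y), E k m i ≤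
      ∑ k ∈ (range K).filter (y < ·), L k * k * h (m + k) ^ 3 / 2 * ((y : ℝ) / k) := by
  rw [← sum_filter_add_sum_filter_not (range K) (y < ·)]
  have hzero : ∑ k ∈ (range K).filter (fun k => ¬ y < k), ∑ i ∈ (range K).filter (· < y), E k m i = 0 :=
    sum_eq_zero fun k hk => sum_eq_zero fun i _ => by
      rw [mem_filter] at hk
      rw [hE, if_neg (fun h3 => hk.2 h3.1)]
  rw [hzero, add_zero]
  exact sum_le_sum fun k hk => by
    rw [mem_filter] at hk
    exact window_sum_le hL hh0 hg hE (by omega) m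

/-- **THE DAMPED YOUNG LOAD IS BELOW THE BUDGET LOAD**: `x̃_y(m) = Σ_{l<K} Ky m l ≤ x_y(m) = y·L_y·h_{m+y}³∕2` (`y ≥ 1`). [folklore] -/
theorem young_load_le (hL : ∀ k, 0 ≤ L k) (hh0 : ∀ n, 0 < h n) (hg : ∀ t, 0 < g t ∧ g t ≤ 1)
    (hKy : ∀ m l, Ky m l = if l < y then L y * h (m + y) ^ 3 / 2 * ∏ t ∈ Ico (m + 1 + l) (m + y + 1), g t else 0)
    (m : ℕ) : ∑ l ∈ range K, Ky m l ≤ L y * y * h (m + y) ^ 3 / 2 := by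
  have hc : 0 ≤ L y * h (m + y) ^ 3 / 2 := div_nonneg (mul_nonneg (hL y) (pow_nonneg (hh0 _).le 3)) (by norm_num)
  rw [← sum_filter_add_sum_filter_not (range K) (· < y)]
  have hzero : ∑ l ∈ (range K).filter (fun l => ¬ l < y), Ky m l = 0 :=
    sum_eq_zero fun l hl => by
      rw [mem_filter] at hl
      rw [hKy, if_neg hl.2]
  rw [hzero, add_zero]
  have hterm : ∀ l ∈ (range K).filter (· < y), Ky m l ≤ L y * h (m + y) ^ 3 / 2 := by
    intro l _
    rw [hKy]
    split_ifs
    · exact mul_le_of_le_one_right hc (prod_damping_le_one hg _)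
    · exact hc
  have hcard : (((range K).filter (· < y)).card : ℝ) ≤ y := by
    have : (range K).filter (· < y) ⊆ range y := fun i hi => by
      simp only [mem_filter, mem_range] at hi ⊢; exact hi.2
    exact_mod_cast (card_le_card this).trans (card_range y).le
  calc ∑ l ∈ (range K).filter (· < y), Ky m l ≤ ∑ _l ∈ (range K).filter (· < y), L y * h (m + y) ^ 3 / 2 := sum_le_sum hterm
    _ = (((range K).filter (· < y)).card : ℝ) * (L y * h (m + y) ^ 3 / 2) := by rw [sum_const, nsmul_eq_mul]
    _ ≤ (y : ℝ) * (L y * h (m + y) ^ 3 / 2) := mul_le_mul_of_nonneg_right hcard hc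
    _ = L y * y * h (m + y) ^ 3 / 2 := by ring

/-! ## §3 The window budget at every pin -/

/-- **THE WINDOW LOAD BUDGET AT EVERY PIN.**  The loads `x_k(m) = k·L_k·h_{m+k}³∕2` at the pin `m` satisfy (E65a)'s budget at every scale `j ≥ 1`:
`Σ_{k<K} L_k·k·h_{m+k}³·W_j(k) ≤ 1`, `W_j(k) = S_{k,j}∕j` (`k ≤ j`), `S_{k,j}∕k` (`k > j`), `S_{k,j} = Σ_{l<j} √(k∕(k+l+1))` — (E65a) `load_budget_window` for the
tail flow from the pin `h_m` (`memFlow_tail`).  This is the polytope over which the budget-form static closure is stated (README g62∕e71 §PS4). [folklore] -/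
theorem load_budget_window_at_pin (hmono : ∀ u v : ℕ → ℝ, SeqBox γ u → SeqBox γ v → (∀ j, u j ≤ v j) → B u ≤ B v) (hL : ∀ k, 0 ≤ L k)
    (hb : 0 < b) (hlo : ∀ u, SeqBox γ u → b ≤ B u) (hdom : ∀ u, SeqBox γ u → ∑ k ∈ range K, L k * u k ≤ B u)
    (hh : SeqBox γ h) (hf : MemFlow B gIR h) (m : ℕ) {j : ℕ} (hj : 1 ≤ j) :
    ∑ k ∈ range K, L k * k * h (m + k) ^ 3 *
      (if k ≤ j then (∑ l ∈ range j, Real.sqrt ((k : ℝ) / ((k : ℝ) + l + 1))) / j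
        else (∑ l ∈ range j, Real.sqrt ((k : ℝ) / ((k : ℝ) + l + 1))) / k) ≤ 1 :=
  load_budget_window hmono hL hb hlo hdom (hh m).1 (seqBox_shift hh m) (memFlow_tail hf m) hj

/-- **THE SINGLE-AGE CAP AT EVERY PIN**: `L_k·h_{m+k}³·S_{k,k} ≤ 1`, i.e. `x_k(m) ≤ k∕(2S_{k,k})` (`→ (√2+1)∕4`), for every age `k < K` at every pin `m`
((E65a) `load_le_readWindow` for the tail flow). [folklore] -/
theorem load_le_cap_at_pin (hmono : ∀ u v : ℕ → ℝ, SeqBox γ u → SeqBox γ v → (∀ j, u j ≤ v j) → B u ≤ B v) (hL : ∀ k, 0 ≤ L k)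
    (hb : 0 < b) (hlo : ∀ u, SeqBox γ u → b ≤ B u) (hdom : ∀ u, SeqBox γ u → ∑ k ∈ range K, L k * u k ≤ B u)
    (hh : SeqBox γ h) (hf : MemFlow B gIR h) (m : ℕ) {k : ℕ} (hkK : k ∈ range K) :
    L k * h (m + k) ^ 3 * ∑ l ∈ range k, Real.sqrt ((k : ℝ) / ((k : ℝ) + l + 1)) ≤ 1 :=
  load_le_readWindow hmono hL hb hlo hdom (hh m).1 (seqBox_shift hh m) (memFlow_tail hf m) hkK

end Summit.QuantumFields.BalabanUV.Beta.EriceRemainderEnclosureHistoryAutonomyComparisonAgeCompositionIdentification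

end
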